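import Literature.Probability.LatticeModels.RandomClusterEdgeWeights
import Summits.CriticalPhenomena.PercolationContinuityZ3.Theorems.PercNearOneGluingNoHeavyLowerTailRefinedRowR3Switching
import HarnessLib

/-!
# Folding for the random-cluster measure: fibrewise (q-weighted antipodal) inequalities lift to `φ_{𝐩,q}`

Support file for `stmt-CriticalPhenomena-4575` (memos `prim-gen-kcluster/KCLUSTER-gen52.md` §1 "LEMMA F",
`KCLUSTER-gen63.md` §4).  For a product measure `P_𝐩 ⊗ P_𝐩` on pairs of configurations, grouping the pairs
`(ω, ω')` by their *folding fibre* `(ω ∩ ω', ω ∪ ω')` makes the product weight constant on each fibre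
(`weight(ω) weight(ω') = weight(ω ∩ ω') weight(ω ∪ ω')`, tree:
`Literature.Probability.Percolation.BHK2006.weight_inter_mul_union`); this is the folding of
van den Berg–Fiebig / Reimer / van den Berg–Gandolfi (tree: `FoldingFibres.lean` for product measures).
For the random-cluster measure `φ = rcMeasureW w q B` (tree: `Literature.Probability.LatticeModels.rcMeasureW`)
the same grouping leaves inside each fibre the cluster factor `q^{k(ω)} q^{k(ω')}` — on the fibre
`(u, v)` this is the grade weight `q^{k(O)+k(K)}` of the antipodal 2-colouring problem on the minor
`H/u ∖ (E ∖ v)` (conjecture ANTI₁ of the memos).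

**Theorem** (`RCFolding.rcMeasureW_real_mul_le_of_fibrewise`).  Let `0 < q` and let
`A₁, A₂, C₁, C₂` be events.  If on every folding fibre `(u, v)` the `q`-weighted count of pairs in
`A₁ × A₂` is at most that of pairs in `C₁ × C₂`, i.e.
`Σ_{ω∩ω'=u, ω∪ω'=v} q^{k(ω)} q^{k(ω')} 1_{A₁}(ω) 1_{A₂}(ω') ≤ Σ_{ω∩ω'=u, ω∪ω'=v} q^{k(ω)} q^{k(ω')} 1_{C₁}(ω) 1_{C₂}(ω')`,
then `φ(A₁) φ(A₂) ≤ φ(C₁) φ(C₂)` for every edge-parameter vector `w`.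

In particular the fibrewise ("graded" or "dominated", `q ≥ 1`) form of the refined row R1 — conjecture
ANTI₁-GRADED — implies R1 `t·s_a ≤ u_b·u_c` for every `φ_{𝐩,q}`; this file supplies the lifting step as a
kernel theorem, so that any fibrewise result (a census certificate for a fixed small graph, or a class
theorem on a rooted-minor-closed class) becomes a statement about the random-cluster measure.  [this work]
-/

noncomputable section

open Finset
open scoped Classical

namespace Summit.CriticalPhenomena.PercolationContinuityZ3.Theorems

namespace RCFolding

open Literature.Probability.Percolation (BondConfig)
open Literature.Probability.Percolation.BHK2006 (weight weight_nonneg weight_inter_mul_union)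
open Literature.Probability.Percolation.DecisionTree (ind ind_of_mem ind_of_not_mem)
open Literature.Probability.LatticeModels (rcWeightW rcPartitionFunctionW rcMeasureW clusterCount
  rcWeightW_nonneg rcPartitionFunctionW_pos rcMeasureW_real_eq_sum_div)

variable {V : Type*} [Fintype V] (w : Sym2 V → unitInterval)

/-- The `q`-weighted fibre sum of pairs in `A₁ × A₂` on the folding fibre `(u, v)`:
`Σ_{ω ∩ ω' = u, ω ∪ ω' = v} q^{k^B(ω)} q^{k^B(ω')} 1_{A₁}(ω) 1_{A₂}(ω')`, written as a double sum with an
indicator (no new definition is introduced; this abbreviates the docstrings only). -/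
theorem fibreSum_nonneg {q : ℝ} (hq : 0 ≤ q) (B : Set V) (A₁ A₂ : Set (BondConfig V))
    (u v : BondConfig V) :
    0 ≤ ∑ ω : BondConfig V, ∑ ω' : BondConfig V,
      (if ω ∩ ω' = u ∧ ω ∪ ω' = v then
        q ^ clusterCount ω B * q ^ clusterCount ω' B * ind A₁ ω * ind A₂ ω' else 0) := by
  refine Finset.sum_nonneg fun ω _ => Finset.sum_nonneg fun ω' _ => ?_
  split_ifs
  · refine mul_nonneg (mul_nonneg (mul_nonneg (pow_nonneg hq _) (pow_nonneg hq _)) ?_) ?_ <;>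
      · unfold ind; split_ifs <;> norm_num
  · exact le_rfl

omit [Fintype V] in
/-- The coordinates of `w` lie in `[0, 1]`. [folklore] -/
private theorem coe_w_nonneg (e : Sym2 V) : 0 ≤ (w e : ℝ) := (w e).2.1

omit [Fintype V] in
/-- The coordinates of `w` lie in `[0, 1]`. [folklore] -/
private theorem coe_w_le_one (e : Sym2 V) : (w e : ℝ) ≤ 1 := (w e).2.2

/-- The product of two random-cluster weights, regrouped on the folding fibre: the Bernoulli part
depends only on `(ω ∩ ω', ω ∪ ω')`. [this work] -/
theorem rcWeightW_mul (q : ℝ) (B : Set V) (ω ω' : BondConfig V) :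
    rcWeightW w q B ω * rcWeightW w q B ω' =
      weight (fun e => (w e : ℝ)) (ω ∩ ω') * weight (fun e => (w e : ℝ)) (ω ∪ ω') *
        (q ^ clusterCount ω B * q ^ clusterCount ω' B) := by
  unfold rcWeightW
  rw [← weight_inter_mul_union]
  ring

/-- Inserting the fibre decomposition: a function of the fibre label, restricted by the indicator of the
fibre of `(ω, ω')` and summed over all labels `(u, v)`, is its value at `(ω ∩ ω', ω ∪ ω')`. [folklore] -/
theorem sum_fibre_indicator (g : BondConfig V → BondConfig V → ℝ) (ω ω' : BondConfig V) :
    ∑ u : BondConfig V, ∑ v : BondConfig V, (if ω ∩ ω' = u ∧ ω ∪ ω' = v then g u v else 0) =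
      g (ω ∩ ω') (ω ∪ ω') := by
  rw [Finset.sum_eq_single (ω ∩ ω')]
  · rw [Finset.sum_eq_single (ω ∪ ω')]
    · simp
    · intro v _ hv
      rw [if_neg]
      exact fun h => hv h.2.symm
    · intro h; exact absurd (Finset.mem_univ _) h
  · intro u _ hu
    refine Finset.sum_eq_zero fun v _ => ?_
    rw [if_neg]
    exact fun h => hu h.1.symm
  · intro h; exact absurd (Finset.mem_univ _) h

/-- Exchanging a pair of outer summations with a pair of inner ones. [folklore] -/
theorem sum_four_comm {α β : Type*} (s : Finset α) (t : Finset β) (F : α → α → β → β → ℝ) :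
    ∑ x ∈ s, ∑ y ∈ s, ∑ u ∈ t, ∑ v ∈ t, F x y u v = ∑ u ∈ t, ∑ v ∈ t, ∑ x ∈ s, ∑ y ∈ s, F x y u v := by
  calc ∑ x ∈ s, ∑ y ∈ s, ∑ u ∈ t, ∑ v ∈ t, F x y u v
      = ∑ x ∈ s, ∑ u ∈ t, ∑ y ∈ s, ∑ v ∈ t, F x y u v :=
        Finset.sum_congr rfl fun x _ => Finset.sum_comm
    _ = ∑ u ∈ t, ∑ x ∈ s, ∑ y ∈ s, ∑ v ∈ t, F x y u v := Finset.sum_comm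
    _ = ∑ u ∈ t, ∑ x ∈ s, ∑ v ∈ t, ∑ y ∈ s, F x y u v :=
        Finset.sum_congr rfl fun u _ => Finset.sum_congr rfl fun x _ => Finset.sum_comm
    _ = ∑ u ∈ t, ∑ v ∈ t, ∑ x ∈ s, ∑ y ∈ s, F x y u v :=
        Finset.sum_congr rfl fun u _ => Finset.sum_comm

/-- **Folding for the random-cluster measure.**  If the `q`-weighted fibre count of `A₁ × A₂` is at most
that of `C₁ × C₂` on every folding fibre `(u,v)`, then `φ(A₁) φ(A₂) ≤ φ(C₁) φ(C₂)` for
`φ = rcMeasureW w q B`, `0 < q`. [this work] -/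
theorem rcMeasureW_real_mul_le_of_fibrewise {q : ℝ} (hq : 0 < q) (B : Set V)
    (A₁ A₂ C₁ C₂ : Set (BondConfig V))
    (h : ∀ u v : BondConfig V,
      ∑ ω : BondConfig V, ∑ ω' : BondConfig V,
          (if ω ∩ ω' = u ∧ ω ∪ ω' = v then
            q ^ clusterCount ω B * q ^ clusterCount ω' B * ind A₁ ω * ind A₂ ω' else 0) ≤
        ∑ ω : BondConfig V, ∑ ω' : BondConfig V,
          (if ω ∩ ω' = u ∧ ω ∪ ω' = v then
            q ^ clusterCount ω B * q ^ clusterCount ω' B * ind C₁ ω * ind C₂ ω' else 0)) :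
    (rcMeasureW w q B).real A₁ * (rcMeasureW w q B).real A₂ ≤
      (rcMeasureW w q B).real C₁ * (rcMeasureW w q B).real C₂ := by
  have hZ := rcPartitionFunctionW_pos w hq B
  rw [rcMeasureW_real_eq_sum_div w hq B A₁, rcMeasureW_real_eq_sum_div w hq B A₂,
    rcMeasureW_real_eq_sum_div w hq B C₁, rcMeasureW_real_eq_sum_div w hq B C₂,
    div_mul_div_comm, div_mul_div_comm]
  refine div_le_div_of_nonneg_right ?_ (mul_pos hZ hZ).le
  rw [Finset.sum_mul_sum, Finset.sum_mul_sum]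
  -- rewrite each pair term on its fibre
  set W : BondConfig V → ℝ := fun u => weight (fun e => (w e : ℝ)) u with hW
  have hWnn : ∀ u, 0 ≤ W u := fun u => weight_nonneg (coe_w_nonneg w) (coe_w_le_one w) u
  have key : ∀ (X Y : Set (BondConfig V)) (ω ω' : BondConfig V),
      rcWeightW w q B ω * ind X ω * (rcWeightW w q B ω' * ind Y ω') =
        ∑ u : BondConfig V, ∑ v : BondConfig V, (if ω ∩ ω' = u ∧ ω ∪ ω' = v then
          W u * W v * (q ^ clusterCount ω B * q ^ clusterCount ω' B * ind X ω * ind Y ω') else 0) := by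
    intro X Y ω ω'
    rw [sum_fibre_indicator (fun u v => W u * W v *
      (q ^ clusterCount ω B * q ^ clusterCount ω' B * ind X ω * ind Y ω')) ω ω']
    have := rcWeightW_mul w q B ω ω'
    calc rcWeightW w q B ω * ind X ω * (rcWeightW w q B ω' * ind Y ω')
        = (rcWeightW w q B ω * rcWeightW w q B ω') * (ind X ω * ind Y ω') := by ring
      _ = W (ω ∩ ω') * W (ω ∪ ω') * (q ^ clusterCount ω B * q ^ clusterCount ω' B) *
            (ind X ω * ind Y ω') := by rw [this]
      _ = _ := by ring
  have regroup : ∀ (X Y : Set (BondConfig V)),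
      ∑ ω : BondConfig V, ∑ ω' : BondConfig V, rcWeightW w q B ω * ind X ω * (rcWeightW w q B ω' * ind Y ω') =
        ∑ u : BondConfig V, ∑ v : BondConfig V, W u * W v *
          ∑ ω : BondConfig V, ∑ ω' : BondConfig V, (if ω ∩ ω' = u ∧ ω ∪ ω' = v then
            q ^ clusterCount ω B * q ^ clusterCount ω' B * ind X ω * ind Y ω' else 0) := by
    intro X Y
    simp_rw [key X Y]
    rw [sum_four_comm]
    refine Finset.sum_congr rfl fun u _ => Finset.sum_congr rfl fun v _ => ?_
    rw [Finset.mul_sum]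
    refine Finset.sum_congr rfl fun ω _ => ?_
    rw [Finset.mul_sum]
    refine Finset.sum_congr rfl fun ω' _ => ?_
    split_ifs
    · rfl
    · rw [mul_zero]
  rw [regroup A₁ A₂, regroup C₁ C₂]
  refine Finset.sum_le_sum fun u _ => Finset.sum_le_sum fun v _ => ?_
  exact mul_le_mul_of_nonneg_left (h u v) (mul_nonneg (hWnn u) (hWnn v))

/-! ### The refined row R1 for `φ_{𝐩,q}` from its fibrewise form -/

section R1

variable [DecidableEq V]

open RefinedRowR3 Literature.Probability.Percolation.Gladkov in
/-- **R1-RC from fibrewise R1.**  In the vocabulary of `SepDual.r3_of_r1_rcMeasureW` (hypothesis `hR1a`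
there): if on every folding fibre `(u, v)` the `q`-weighted count of pairs `(ω, ω') ∈ T × S_a`
(`T = Sep_a Sep_b Sep_c`, `S_a = Sep_a ¬Sep_b ¬Sep_c`) is at most that of pairs in `U_b × U_c`
(the two factors printed in `hR1a`: `Sep_a ¬Sep_b Sep_c` and `Sep_a Sep_b ¬Sep_c`), then the refined row R1 `φ(T) φ(S_a) ≤ φ(Sep_a ¬Sep_b Sep_c) φ(Sep_a Sep_b ¬Sep_c)`
holds for `φ = rcMeasureW w q ∅`, every `w` and every `0 < q`.  The fibrewise hypothesis is the graded /
dominated antipodal statement ANTI₁ of the memos written on the configurations of the graph itself. [this work] -/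
theorem r1_rcMeasureW_of_fibrewise (D : Finset (Sym2 V)) {q : ℝ} (hq : 0 < q) (a b c : V)
    (h : ∀ u v : BondConfig V,
      ∑ ω : BondConfig V, ∑ ω' : BondConfig V,
          (if ω ∩ ω' = u ∧ ω ∪ ω' = v then
            q ^ clusterCount ω ∅ * q ^ clusterCount ω' ∅ *
              ind {ω : BondConfig V | Sep D (cl ω.toFinset a) b c ∧
                Sep D (cl ω.toFinset b) a c ∧ Sep D (cl ω.toFinset c) a b} ω *
              ind {ω : BondConfig V | Sep D (cl ω.toFinset a) b c ∧
                ¬ Sep D (cl ω.toFinset b) a c ∧ ¬ Sep D (cl ω.toFinset c) a b} ω' else 0) ≤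
        ∑ ω : BondConfig V, ∑ ω' : BondConfig V,
          (if ω ∩ ω' = u ∧ ω ∪ ω' = v then
            q ^ clusterCount ω ∅ * q ^ clusterCount ω' ∅ *
              ind {ω : BondConfig V | Sep D (cl ω.toFinset a) b c ∧
                ¬ Sep D (cl ω.toFinset b) a c ∧ Sep D (cl ω.toFinset c) a b} ω *
              ind {ω : BondConfig V | Sep D (cl ω.toFinset a) b c ∧
                Sep D (cl ω.toFinset b) a c ∧ ¬ Sep D (cl ω.toFinset c) a b} ω' else 0)) :
    (rcMeasureW w q ∅).real {ω : BondConfig V | Sep D (cl ω.toFinset a) b c ∧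
          Sep D (cl ω.toFinset b) a c ∧ Sep D (cl ω.toFinset c) a b} *
        (rcMeasureW w q ∅).real {ω : BondConfig V | Sep D (cl ω.toFinset a) b c ∧
          ¬ Sep D (cl ω.toFinset b) a c ∧ ¬ Sep D (cl ω.toFinset c) a b} ≤
      (rcMeasureW w q ∅).real {ω : BondConfig V | Sep D (cl ω.toFinset a) b c ∧
          ¬ Sep D (cl ω.toFinset b) a c ∧ Sep D (cl ω.toFinset c) a b} *
        (rcMeasureW w q ∅).real {ω : BondConfig V | Sep D (cl ω.toFinset a) b c ∧
          Sep D (cl ω.toFinset b) a c ∧ ¬ Sep D (cl ω.toFinset c) a b} :=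
  rcMeasureW_real_mul_le_of_fibrewise w hq ∅ _ _ _ _ h

end R1


/-! ### Support-restricted form: the fibrewise hypothesis is only needed on fibres inside the graph -/

section Support

/-- A configuration containing an edge of weight zero has Bernoulli weight zero. [folklore] -/
theorem weight_eq_zero_of_mem {ω : BondConfig V} {e : Sym2 V} (he : e ∈ ω) (hw : (w e : ℝ) = 0) :
    weight (fun e => (w e : ℝ)) ω = 0 := by
  unfold weight
  exact Finset.prod_eq_zero (Finset.mem_univ e) (by rw [if_pos he]; exact hw)

/-- **Folding for the random-cluster measure of a graph `D ⊆ Sym2 V`.**  If every edge outside `D` has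
weight `0` (so `φ = rcMeasureW w q B` is the random-cluster measure of the graph `D`), the fibrewise
hypothesis of `rcMeasureW_real_mul_le_of_fibrewise` is only needed on the folding fibres `(u, v)` with
`v ⊆ D` — i.e. on the rooted minors `D/u ∖ (D ∖ v)` of the graph itself: then
`φ(A₁) φ(A₂) ≤ φ(C₁) φ(C₂)`. [this work] -/
theorem rcMeasureW_real_mul_le_of_fibrewise_on {q : ℝ} (hq : 0 < q) (B : Set V) (D : Set (Sym2 V))
    (hD : ∀ e, e ∉ D → (w e : ℝ) = 0) (A₁ A₂ C₁ C₂ : Set (BondConfig V))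
    (h : ∀ u v : BondConfig V, v ⊆ D →
      ∑ ω : BondConfig V, ∑ ω' : BondConfig V,
          (if ω ∩ ω' = u ∧ ω ∪ ω' = v then
            q ^ clusterCount ω B * q ^ clusterCount ω' B * ind A₁ ω * ind A₂ ω' else 0) ≤
        ∑ ω : BondConfig V, ∑ ω' : BondConfig V,
          (if ω ∩ ω' = u ∧ ω ∪ ω' = v then
            q ^ clusterCount ω B * q ^ clusterCount ω' B * ind C₁ ω * ind C₂ ω' else 0)) :
    (rcMeasureW w q B).real A₁ * (rcMeasureW w q B).real A₂ ≤
      (rcMeasureW w q B).real C₁ * (rcMeasureW w q B).real C₂ := by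
  have hZ := rcPartitionFunctionW_pos w hq B
  rw [rcMeasureW_real_eq_sum_div w hq B A₁, rcMeasureW_real_eq_sum_div w hq B A₂,
    rcMeasureW_real_eq_sum_div w hq B C₁, rcMeasureW_real_eq_sum_div w hq B C₂,
    div_mul_div_comm, div_mul_div_comm]
  refine div_le_div_of_nonneg_right ?_ (mul_pos hZ hZ).le
  rw [Finset.sum_mul_sum, Finset.sum_mul_sum]
  set W : BondConfig V → ℝ := fun u => weight (fun e => (w e : ℝ)) u with hW
  have hWnn : ∀ u, 0 ≤ W u := fun u => weight_nonneg (coe_w_nonneg w) (coe_w_le_one w) u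
  have hW0 : ∀ v : BondConfig V, ¬ v ⊆ D → W v = 0 := by
    intro v hv
    obtain ⟨e, hev, heD⟩ := Set.not_subset.1 hv
    exact weight_eq_zero_of_mem w hev (hD e heD)
  have key : ∀ (X Y : Set (BondConfig V)) (ω ω' : BondConfig V),
      rcWeightW w q B ω * ind X ω * (rcWeightW w q B ω' * ind Y ω') =
        ∑ u : BondConfig V, ∑ v : BondConfig V, (if ω ∩ ω' = u ∧ ω ∪ ω' = v then
          W u * W v * (q ^ clusterCount ω B * q ^ clusterCount ω' B * ind X ω * ind Y ω') else 0) := by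
    intro X Y ω ω'
    rw [sum_fibre_indicator (fun u v => W u * W v *
      (q ^ clusterCount ω B * q ^ clusterCount ω' B * ind X ω * ind Y ω')) ω ω']
    have := rcWeightW_mul w q B ω ω'
    calc rcWeightW w q B ω * ind X ω * (rcWeightW w q B ω' * ind Y ω')
        = (rcWeightW w q B ω * rcWeightW w q B ω') * (ind X ω * ind Y ω') := by ring
      _ = W (ω ∩ ω') * W (ω ∪ ω') * (q ^ clusterCount ω B * q ^ clusterCount ω' B) *
            (ind X ω * ind Y ω') := by rw [this]
      _ = _ := by ring
  have regroup : ∀ (X Y : Set (BondConfig V)),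
      ∑ ω : BondConfig V, ∑ ω' : BondConfig V, rcWeightW w q B ω * ind X ω * (rcWeightW w q B ω' * ind Y ω') =
        ∑ u : BondConfig V, ∑ v : BondConfig V, W u * W v *
          ∑ ω : BondConfig V, ∑ ω' : BondConfig V, (if ω ∩ ω' = u ∧ ω ∪ ω' = v then
            q ^ clusterCount ω B * q ^ clusterCount ω' B * ind X ω * ind Y ω' else 0) := by
    intro X Y
    simp_rw [key X Y]
    rw [sum_four_comm]
    refine Finset.sum_congr rfl fun u _ => Finset.sum_congr rfl fun v _ => ?_
    rw [Finset.mul_sum]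
    refine Finset.sum_congr rfl fun ω _ => ?_
    rw [Finset.mul_sum]
    refine Finset.sum_congr rfl fun ω' _ => ?_
    split_ifs
    · rfl
    · rw [mul_zero]
  rw [regroup A₁ A₂, regroup C₁ C₂]
  refine Finset.sum_le_sum fun u _ => Finset.sum_le_sum fun v _ => ?_
  by_cases hv : v ⊆ D
  · exact mul_le_mul_of_nonneg_left (h u v hv) (mul_nonneg (hWnn u) (hWnn v))
  · rw [hW0 v hv, mul_zero, zero_mul, zero_mul]

end Support

end RCFolding

end Summit.CriticalPhenomena.PercolationContinuityZ3.Theorems
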